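import Literature.MathematicalPhysics.QuantumFieldTheory.Balaban1983to89.B9Thm32Conv348AtKnitLetterOfRegYP335

/-!
# `Balaban1983to89.B9Thm32KnitRows1516ThresholdsY` — T. Bałaban, *Propagators for lattice gauge theories in a background field*, Commun. Math. Phys. **99** (1985)
# 389–434 [Balaban1985BackgroundPropagators], THEOREM 3.2 (3.48) FOR `(Q′G′²Q′*)⁻¹` AT THE KNIT TRANSPORTERS ON PRINT's CLASS (3.35): this seat's member theorem
# `B9Thm32Conv348AtKnitLetterOfRegYP335.conv348_oneCube_parKnitY_of_regYP335_section` WITH ITS FOUR EXISTENTIAL CONSTANTS NAMED (`knit348M₁`, `knit348a₁`,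
# `knit348B₀`, `knit348δ₀`), THE (B, δ)-MONOTONICITY OF `Conv348Blk`, AND THE N06 KNIT HEAD's ROWS-15∕16 DISPLAY `h348` AT A SECTION-CARRYING MEMBER AT ANY
# DOMINATED THRESHOLDS (dag-n06-d g29's by-name ask «B9Thm32KnitRows1516ThresholdsY», 2026-08-31; the pattern of `B9Thm311KnitRow17ThresholdsY`)

statement-level skeleton of published theorems with citation tags; proofs where landed; nothing here is a claim about the Yang–Mills mass gap

THE PRINT.  Thm 3.2 (3.48) p. 398 (*«|(Q′G′²Q′\*)⁻¹(y, y′)| ≦ B₀(Lʲη)⁻⁴ e^{−δ₀d(y,y′)}»*) and its proof (3.95)–(3.96) p. 411 (`(Q′G′²Q′*)⁻¹ = C₀(I − R)⁻¹ = Σ C₀Rⁿ`); (3.19)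
p. 393 (the knit transporters); (3.25) p. 394; (3.35) p. 396 (the cube class — print's «α₀ sufficiently small», «M sufficiently large» are two of the four constants
named here, `B₀`, `δ₀` of (3.48) the other two); [4] = *Propagators and renormalization transformations … II*, Commun. Math. Phys. **96** (1984), (2.51) p. 232, (2.86) p. 238
(the block-majorant currency of `Conv348Blk`).

WHY THIS FILE (cell `pub-ymgap`, node N06, seat `dag-n06-j` gen 38 = bundle F5 rows 15∕16).  The knit head «KE₇X» displays rows 15∕16 as
`h348 : ∀ x, M39 ≤ M → ∀ α₀ > 0, c·M·α₀ ≤ a39 → ∀ U ∈ (bg9YR … R₁ R₂ x).Reg335 c α₀, Conv348Blk (oneCubeOps39 (geo9Y x) (bg9YR … x) (blk39F … (bI x)) (L39 x (parKnitY x) (𝔏 x).Gp)) B39 δ39 U`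
over ALL members with four free thresholds `M39 a39 B39 δ39`; the supplier `conv348_oneCube_parKnitY_of_regYP335_section θ M⋆ hN` reads `∃ M₁ a₁ B₀ δ₀ > 0, ∀ bI hβI x,
Surjective β → M₁ ≤ M → ∀ α₀ > 0, c₃₅·M·α₀ ≤ a₁ → ∀ U ∈ (bg9YP … x).Reg335 c₃₅ α₀, Conv348Blk … B₀ δ₀ U`.  To CONSUME it at every section-carrying member and keep
the display only at the others (dag-n06-d's «KE₉X» recipe, `Classical.em (Surjective β)`), the head needs the four constants as CLOSED TERMS (x-free numerics rows
`c₃₅·a39 ≤ c·knit348a₁`, `knit348B₀ ≤ B39`, `δ39 ≤ knit348δ₀`, threshold `M39 := knit348M₁`) and the monotonicity of `Conv348Blk` in `(B, δ)` — both supplied here.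

WHAT IS PROVED (4 `def` = names of existing existential constants, chosen at the carrier's own finite-type structure `(kGeoU ·).fin` on the index bonds so that they are
instance-free closed terms; theorems sorry-free, stated for an ARBITRARY `[∀ x, Fintype (geo9Y x).Site]` by subsingleton transport).
* §1 `knit348M₁`, `knit348a₁`, `knit348B₀`, `knit348δ₀` (defs) and `_pos` ×4;
* §2 ★ `conv348Blk_mono` — `Conv348Blk 𝔬 B₀ δ₀ U → 0 ≤ B₀ → B₀ ≤ B₁ → δ₁ ≤ δ₀ → (0 ≤ len) → (0 ≤ dist) → Conv348Blk 𝔬 B₁ δ₁ U` (generic `Ops39Blk`; [4] (2.51) is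
  monotone in the majorant), `conv348Blk_mono_geo9Y` (the two sign conditions discharged at `geo9Y x`);
* §3 ★ `conv348_oneCube_parKnitY_at` — the member theorem at the named constants; ★ `conv348_oneCube_parKnitY_at_of_le` — at any `(B, δ)` with `knit348B₀ ≤ B`,
  `δ ≤ knit348δ₀`; ★★ `conv348_oneCube_parKnitY_regYR_at` — THE HEAD's `h348` BODY at a section-carrying member: R-generic premise `(bg9YR … R₁ R₂ x).Reg335 c α₀ U`
  through the displayed class transfer `hRP1` (`0 < c`), the head's guard `c·M·α₀ ≤ a39` and the three numerics rows; ★★ `conv348_oneCube_parKnitY_regYR_at_letters` —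
  the same with the `G′`-slot read through a letters family `𝔏` pinned by `(𝔏 x).Gp = GpY x (parKnitY x)` (the head's literal spelling, pin `rfl` at the record);
  `conv348_oneCube_parKnitY_regYR_at_scMemberY` — keyed by n06-c's carrier `SCMemberY`.
HONEST SCOPE.  Naming, unpacking and a two-line monotonicity only; no estimate of [B9] asserted or re-proved; SECTION-CARRYING members only (members whose carrier-block
map `β` is onto — at the others the head's display stays displayed; IR-N06-SECTION-2 is the member-class question of record); helper, count-neutral; N06 NOT discharged;
nothing continuum ∕ OS ∕ mass gap ∕ Clay — the Yang–Mills mass gap is NOT proved here.  No `sorry`, no `axiom`, no `instance`, no `notation`.  NEW file (definition lane).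
RELATED, NOT DUPLICATED (searched 2026-08-31: `ls Literature/…/Balaban1983to89 | grep -i 'KnitRows1516Thresholds'` = ∅; `lean search 'conv348Blk|Conv348Blk' --decl` = 10
declarations, none a (B, δ)-monotonicity): this seat's `B9Thm32Conv348AtKnitLetterOfRegYP335` (the theorem whose constants are named — USED), `B9Thm311KnitRow17ThresholdsY`
(the row-17 twin, pattern), `B6RandomWalk.hasMajorant_mono` (USED).
-/

noncomputable section

namespace Literature.MathematicalPhysics.QuantumFieldTheory.Balaban1983to89.B9Thm32KnitRows1516ThresholdsY

open Literature.MathematicalPhysics.QuantumFieldTheory.Balaban1983to89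
open B6RandomWalk B9Thm39WholeBlk B9Thm39ReadingCoords B9Thm39ReadingAtLetters B9Thm39OneCubeReadingAtLettersY Node00
open B6KLevelCensusIndexV1 B6Ineq2142KLevelV1 B6GlobalChartV1 B9PinMembersKLevelV1 B9PinGeometryKLevelV1 B9GeoNormsKLevelV1
  B9BackgroundsKLevelV1 B9BackgroundsKLevelV1P B9BackgroundsKLevelV1R B9Thm34Ext B9SectionCarryingMembersV1
open Literature.MathematicalPhysics.QuantumFieldTheory.Balaban1983to89.B9Ineq349SiteFromConv348 (rep39F blk39F beta_rep39F_beta)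
open Literature.MathematicalPhysics.QuantumFieldTheory.Balaban1983to89.B9GeoLemma21KLevelV1 (geo9K_len_pos geo9Y_len_pos)
open Literature.MathematicalPhysics.QuantumFieldTheory.Balaban1983to89.B9B8AveragingJunction (parKnitY)
open Literature.MathematicalPhysics.QuantumFieldTheory.Balaban1983to89.B9Thm32Conv348AtKnitLetterOfRegYP335 (conv348_oneCube_parKnitY_of_regYP335_section)
open B7Prop2SpecialUnitary
open scoped Matrix.Norms.L2Operator

/-! ## §1 The four constants of rows 15∕16 at the knit record, named -/

section Named

variable (N : ℕ) [Nonempty (Fin N)] (θ : Stage3Params) (Mstar : ℕ)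

/-- `1 ≤ N` from the head's instance `[Nonempty (Fin N)]`. [folklore] -/
private theorem one_le_N : 1 ≤ N := Fin.pos_iff_nonempty.2 ‹_›

/-- The member theorem at the carrier's own finite-type structure `(kGeoU ·).fin` on the index bonds (the existential statement whose constants are named;
choosing them here makes the four names closed terms free of any `Fintype` binder). [cite: Balaban1985BackgroundPropagators, Thm 3.2 (3.48) p.398, bookkeeping] -/
private theorem spec₀ : ∃ M₁ a₁ B₀ δ₀ : ℝ, 0 < M₁ ∧ 0 < a₁ ∧ 0 < B₀ ∧ 0 < δ₀ ∧
    ∀ (bI : ∀ x : MemberY θ.d₆ θ.ℓ₆ θ.hd' θ.hL' θ.b₀ θ.b₁ Mstar, FBondY x.toKIdx → IBondY x.toKIdx)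
      (_hβI : ∀ (x : MemberY θ.d₆ θ.ℓ₆ θ.hd' θ.hL' θ.b₀ θ.b₁ Mstar) (f : FBondY x.toKIdx) (c : IBondY x.toKIdx),
        blkV1 x.hN x.D f = β x.hN x.D x.hk c → β x.hN x.D x.hk (bI x f) = blkV1 x.hN x.D f)
      (x : MemberY θ.d₆ θ.ℓ₆ θ.hd' θ.hL' θ.b₀ θ.b₁ Mstar), Function.Surjective (β x.hN x.D x.hk) → M₁ ≤ (geo9Y x).M →
      ∀ α₀ : ℝ, 0 < α₀ → c35Y * (geo9Y x).M * α₀ ≤ a₁ →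
      ∀ U : CfgY (Matrix (Fin N) (Fin N) ℂ) x.toKIdx,
        (bg9YP (Matrix (Fin N) (Fin N) ℂ) (specialUnitaryUnits (Fin N)) x).Reg335 c35Y α₀ U →
        @Conv348Blk (geo9Y x) ((kGeoU x.toKIdx).fin) _ _ _ _
          (@oneCubeOps39 (geo9Y x) ((kGeoU x.toKIdx).fin) (bg9YP (Matrix (Fin N) (Fin N) ℂ) (specialUnitaryUnits (Fin N)) x) _
            (blk39F (Matrix (Fin N) (Fin N) ℂ) x.toKIdx (bI x)) (L39 x.toKIdx (parKnitY x.toKIdx) (GpY x.toKIdx (parKnitY x.toKIdx)))) B₀ δ₀ U :=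
  @conv348_oneCube_parKnitY_of_regYP335_section N θ Mstar (fun x => (kGeoU x.toKIdx).fin) (one_le_N N)

/-- **THE THRESHOLD `M₁` OF ROWS 15∕16 AT THE KNIT RECORD, NAMED** (print's «M sufficiently large»; a function of `θ`, `M⋆`, `N` only).
[cite: Balaban1985BackgroundPropagators, Thm 3.2 (3.48) p.398, (3.35) p.396] -/
def knit348M₁ : ℝ := (spec₀ N θ Mstar).choose

/-- **THE SMALLNESS THRESHOLD `a₁` (`c₃₅·M·α₀ ≤ a₁`) OF ROWS 15∕16 AT THE KNIT RECORD, NAMED** (print's «α₀ sufficiently small»).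
[cite: Balaban1985BackgroundPropagators, Thm 3.2 (3.48) p.398, (3.35) p.396] -/
def knit348a₁ : ℝ := (spec₀ N θ Mstar).choose_spec.choose

/-- **THE CONSTANT `B₀` OF (3.48) AT THE KNIT RECORD, NAMED.** [cite: Balaban1985BackgroundPropagators, Thm 3.2 (3.48) p.398] -/
def knit348B₀ : ℝ := (spec₀ N θ Mstar).choose_spec.choose_spec.choose

/-- **THE DECAY RATE `δ₀` OF (3.48) AT THE KNIT RECORD, NAMED.** [cite: Balaban1985BackgroundPropagators, Thm 3.2 (3.48) p.398] -/
def knit348δ₀ : ℝ := (spec₀ N θ Mstar).choose_spec.choose_spec.choose_spec.choose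

/-- The defining property of the four named constants (the member theorem at the canonical instance, unpacked once). [cite: Balaban1985BackgroundPropagators, Thm 3.2 (3.48) p.398, bookkeeping] -/
private theorem spec348 : 0 < knit348M₁ N θ Mstar ∧ 0 < knit348a₁ N θ Mstar ∧ 0 < knit348B₀ N θ Mstar ∧ 0 < knit348δ₀ N θ Mstar ∧
    ∀ (bI : ∀ x : MemberY θ.d₆ θ.ℓ₆ θ.hd' θ.hL' θ.b₀ θ.b₁ Mstar, FBondY x.toKIdx → IBondY x.toKIdx)
      (_hβI : ∀ (x : MemberY θ.d₆ θ.ℓ₆ θ.hd' θ.hL' θ.b₀ θ.b₁ Mstar) (f : FBondY x.toKIdx) (c : IBondY x.toKIdx),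
        blkV1 x.hN x.D f = β x.hN x.D x.hk c → β x.hN x.D x.hk (bI x f) = blkV1 x.hN x.D f)
      (x : MemberY θ.d₆ θ.ℓ₆ θ.hd' θ.hL' θ.b₀ θ.b₁ Mstar), Function.Surjective (β x.hN x.D x.hk) → knit348M₁ N θ Mstar ≤ (geo9Y x).M →
      ∀ α₀ : ℝ, 0 < α₀ → c35Y * (geo9Y x).M * α₀ ≤ knit348a₁ N θ Mstar →
      ∀ U : CfgY (Matrix (Fin N) (Fin N) ℂ) x.toKIdx,
        (bg9YP (Matrix (Fin N) (Fin N) ℂ) (specialUnitaryUnits (Fin N)) x).Reg335 c35Y α₀ U →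
        @Conv348Blk (geo9Y x) ((kGeoU x.toKIdx).fin) _ _ _ _
          (@oneCubeOps39 (geo9Y x) ((kGeoU x.toKIdx).fin) (bg9YP (Matrix (Fin N) (Fin N) ℂ) (specialUnitaryUnits (Fin N)) x) _
            (blk39F (Matrix (Fin N) (Fin N) ℂ) x.toKIdx (bI x)) (L39 x.toKIdx (parKnitY x.toKIdx) (GpY x.toKIdx (parKnitY x.toKIdx))))
          (knit348B₀ N θ Mstar) (knit348δ₀ N θ Mstar) U :=
  (spec₀ N θ Mstar).choose_spec.choose_spec.choose_spec.choose_spec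

/-- `0 < knit348M₁`. [cite: Balaban1985BackgroundPropagators, Thm 3.2 (3.48) p.398, bookkeeping] -/
theorem knit348M₁_pos : 0 < knit348M₁ N θ Mstar := (spec348 N θ Mstar).1

/-- `0 < knit348a₁`. [cite: Balaban1985BackgroundPropagators, Thm 3.2 (3.48) p.398, bookkeeping] -/
theorem knit348a₁_pos : 0 < knit348a₁ N θ Mstar := (spec348 N θ Mstar).2.1

/-- `0 < knit348B₀`. [cite: Balaban1985BackgroundPropagators, Thm 3.2 (3.48) p.398, bookkeeping] -/
theorem knit348B₀_pos : 0 < knit348B₀ N θ Mstar := (spec348 N θ Mstar).2.2.1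

/-- `0 < knit348δ₀`. [cite: Balaban1985BackgroundPropagators, Thm 3.2 (3.48) p.398, bookkeeping] -/
theorem knit348δ₀_pos : 0 < knit348δ₀ N θ Mstar := (spec348 N θ Mstar).2.2.2.1

end Named

/-! ## §2 `Conv348Blk` is monotone in the majorant `(B, δ)` -/

section Mono

variable {g : B9.Geometry} [Fintype g.Site] [DecidableEq g.Site] {B : B9.Backgrounds} {X ι κ : Type} [Fintype X] [DecidableEq X]

omit [DecidableEq g.Site] [Fintype X] [DecidableEq X] in
/-- ★ **(3.48)'s convergence predicate is MONOTONE IN THE MAJORANT**: a two-sided inverse with block majorant `B₀(Lʲη)⁻⁴e^{−δ₀d}` has the block majorant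
`B₁(Lʲη)⁻⁴e^{−δ₁d}` for every `B₁ ≥ B₀ ≥ 0` and `δ₁ ≤ δ₀`, lengths and distances being non-negative ([4] (2.51): a larger `K(y, y′)` is again a majorant).
[cite: Balaban1985BackgroundPropagators, Thm 3.2 (3.48) p.398 + (3.96) p.411; Balaban1984PropagatorsII, (2.51) p.232 (bookkeeping: monotonicity of the majorant)] -/
theorem conv348Blk_mono (𝔬 : Ops39Blk g B X ι κ) {B₀ δ₀ B₁ δ₁ : ℝ} {U : B.Cfg} (h : Conv348Blk 𝔬 B₀ δ₀ U)
    (hB₀ : 0 ≤ B₀) (hB : B₀ ≤ B₁) (hδ : δ₁ ≤ δ₀) (hlen : ∀ a : g.Site, 0 ≤ g.len a) (hdist : ∀ a b : g.Site, 0 ≤ g.dist a b) :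
    Conv348Blk 𝔬 B₁ δ₁ U := by
  obtain ⟨T, h1, h2, hT⟩ := h
  refine ⟨T, h1, h2, hasMajorant_mono _ hT fun a b => ?_⟩
  have hl : 0 ≤ g.len a ^ (-(4 : ℝ)) := Real.rpow_nonneg (hlen a) _
  have he : Real.exp (-(δ₀ * g.dist a b)) ≤ Real.exp (-(δ₁ * g.dist a b)) :=
    Real.exp_le_exp.2 (neg_le_neg (mul_le_mul_of_nonneg_right hδ (hdist a b)))
  exact mul_le_mul (mul_le_mul_of_nonneg_right hB hl) he (Real.exp_nonneg _) (mul_nonneg (hB₀.trans hB) hl)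

end Mono

section MonoY

variable {N : ℕ} {θ : Stage3Params} {Mstar : ℕ}

/-- ★ **The same at def-Y's member geometry `geo9Y x`** (lengths `Lʲη > 0`, torus block distances `≥ 0`): any cube-operator reading over `geo9Y x`.
[cite: Balaban1985BackgroundPropagators, Thm 3.2 (3.48) p.398; Balaban1984PropagatorsII, (2.46) p.231 + (2.51) p.232 (bookkeeping)] -/
theorem conv348Blk_mono_geo9Y (x : MemberY θ.d₆ θ.ℓ₆ θ.hd' θ.hL' θ.b₀ θ.b₁ Mstar) [Fintype (geo9Y x).Site] {B : B9.Backgrounds} {X ι κ : Type}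
    (𝔬 : Ops39Blk (geo9Y x) B X ι κ) {B₀ δ₀ B₁ δ₁ : ℝ} {U : B.Cfg} (h : Conv348Blk 𝔬 B₀ δ₀ U)
    (hB₀ : 0 ≤ B₀) (hB : B₀ ≤ B₁) (hδ : δ₁ ≤ δ₀) : Conv348Blk 𝔬 B₁ δ₁ U :=
  conv348Blk_mono 𝔬 h hB₀ hB hδ (fun a => (geo9Y_len_pos x a).le) (fun a b => geo9K_dist_nonneg x.toKIdx a b)

end MonoY

/-! ## §3 Rows 15∕16 at the knit record at the named (or any dominated) thresholds, section-carrying members -/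

section At

variable (N : ℕ) [Nonempty (Fin N)] (θ : Stage3Params) (Mstar : ℕ)
variable [∀ x : MemberY θ.d₆ θ.ℓ₆ θ.hd' θ.hL' θ.b₀ θ.b₁ Mstar, Fintype (geo9Y x).Site]

/-- ★ **THEOREM 3.2's (3.48) FOR `(Q′G′²Q′*)⁻¹(U; parKnitY)` ON PRINT's CLASS AT THE NAMED CONSTANTS**: for every bond map `bI` with `β ∘ bI ∘ β = β` on carrier blocks,
every section-carrying member `x` with `knit348M₁ ≤ M`, every `α₀ > 0` with `c₃₅·M·α₀ ≤ knit348a₁` and every `SU(N)`-valued `U ∈ (bg9YP … x).Reg335 c₃₅ α₀`: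
`Conv348Blk (oneCubeOps39 (geo9Y x) (bg9YP … x) (blk39F … (bI x)) (L39 x (parKnitY x) (GpY x (parKnitY x)))) knit348B₀ knit348δ₀ U` — at ANY finite-type structure on the index
bonds (subsingleton transport from the canonical one). [cite: Balaban1985BackgroundPropagators, Thm 3.2 (3.48) p.398 + (3.96) p.411 + (3.19) p.393 + (3.25) p.394 + (3.35) p.396; Balaban1984PropagatorsII, (2.51) p.232 + (2.86) p.238] -/
theorem conv348_oneCube_parKnitY_at
    (bI : ∀ x : MemberY θ.d₆ θ.ℓ₆ θ.hd' θ.hL' θ.b₀ θ.b₁ Mstar, FBondY x.toKIdx → IBondY x.toKIdx)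
    (hβI : ∀ (x : MemberY θ.d₆ θ.ℓ₆ θ.hd' θ.hL' θ.b₀ θ.b₁ Mstar) (f : FBondY x.toKIdx) (c : IBondY x.toKIdx),
      blkV1 x.hN x.D f = β x.hN x.D x.hk c → β x.hN x.D x.hk (bI x f) = blkV1 x.hN x.D f)
    (x : MemberY θ.d₆ θ.ℓ₆ θ.hd' θ.hL' θ.b₀ θ.b₁ Mstar) (hsurj : Function.Surjective (β x.hN x.D x.hk)) (hM : knit348M₁ N θ Mstar ≤ (geo9Y x).M)
    (α₀ : ℝ) (hα : 0 < α₀) (ha : c35Y * (geo9Y x).M * α₀ ≤ knit348a₁ N θ Mstar)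
    (U : CfgY (Matrix (Fin N) (Fin N) ℂ) x.toKIdx) (hU : (bg9YP (Matrix (Fin N) (Fin N) ℂ) (specialUnitaryUnits (Fin N)) x).Reg335 c35Y α₀ U) :
    Conv348Blk (oneCubeOps39 (geo9Y x) (bg9YP (Matrix (Fin N) (Fin N) ℂ) (specialUnitaryUnits (Fin N)) x)
      (blk39F (Matrix (Fin N) (Fin N) ℂ) x.toKIdx (bI x)) (L39 x.toKIdx (parKnitY x.toKIdx) (GpY x.toKIdx (parKnitY x.toKIdx))))
      (knit348B₀ N θ Mstar) (knit348δ₀ N θ Mstar) U := by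
  have e : (‹∀ x : MemberY θ.d₆ θ.ℓ₆ θ.hd' θ.hL' θ.b₀ θ.b₁ Mstar, Fintype (geo9Y x).Site›) =
      (fun x : MemberY θ.d₆ θ.ℓ₆ θ.hd' θ.hL' θ.b₀ θ.b₁ Mstar => (kGeoU x.toKIdx).fin) := Subsingleton.elim _ _
  subst e
  exact (spec348 N θ Mstar).2.2.2.2 bI hβI x hsurj hM α₀ hα ha U hU

/-- ★ **THE SAME AT ANY DOMINATED MAJORANT** `(B, δ)` with `knit348B₀ ≤ B`, `δ ≤ knit348δ₀`. [cite: Balaban1985BackgroundPropagators, Thm 3.2 (3.48) p.398 + (3.35) p.396; Balaban1984PropagatorsII, (2.51) p.232] -/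
theorem conv348_oneCube_parKnitY_at_of_le
    (bI : ∀ x : MemberY θ.d₆ θ.ℓ₆ θ.hd' θ.hL' θ.b₀ θ.b₁ Mstar, FBondY x.toKIdx → IBondY x.toKIdx)
    (hβI : ∀ (x : MemberY θ.d₆ θ.ℓ₆ θ.hd' θ.hL' θ.b₀ θ.b₁ Mstar) (f : FBondY x.toKIdx) (c : IBondY x.toKIdx),
      blkV1 x.hN x.D f = β x.hN x.D x.hk c → β x.hN x.D x.hk (bI x f) = blkV1 x.hN x.D f)
    (x : MemberY θ.d₆ θ.ℓ₆ θ.hd' θ.hL' θ.b₀ θ.b₁ Mstar) (hsurj : Function.Surjective (β x.hN x.D x.hk)) (hM : knit348M₁ N θ Mstar ≤ (geo9Y x).M)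
    (α₀ : ℝ) (hα : 0 < α₀) (ha : c35Y * (geo9Y x).M * α₀ ≤ knit348a₁ N θ Mstar)
    {B δ : ℝ} (hB : knit348B₀ N θ Mstar ≤ B) (hδ : δ ≤ knit348δ₀ N θ Mstar)
    (U : CfgY (Matrix (Fin N) (Fin N) ℂ) x.toKIdx) (hU : (bg9YP (Matrix (Fin N) (Fin N) ℂ) (specialUnitaryUnits (Fin N)) x).Reg335 c35Y α₀ U) :
    Conv348Blk (oneCubeOps39 (geo9Y x) (bg9YP (Matrix (Fin N) (Fin N) ℂ) (specialUnitaryUnits (Fin N)) x)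
      (blk39F (Matrix (Fin N) (Fin N) ℂ) x.toKIdx (bI x)) (L39 x.toKIdx (parKnitY x.toKIdx) (GpY x.toKIdx (parKnitY x.toKIdx)))) B δ U :=
  conv348Blk_mono_geo9Y x _ (conv348_oneCube_parKnitY_at N θ Mstar bI hβI x hsurj hM α₀ hα ha U hU) (knit348B₀_pos N θ Mstar).le hB hδ

/-- the head's guard `c·M·α₀ ≤ a39` with the numerics row `c₃₅·a39 ≤ c·knit348a₁` gives the supplier's guard `c₃₅·M·α₀ ≤ knit348a₁` (`0 < c`). [folklore] -/
private theorem guard_of_head {c M α₀ a39 a₁ : ℝ} (hc : 0 < c) (ha : c * M * α₀ ≤ a39) (ha39 : c35Y * a39 ≤ c * a₁) : c35Y * M * α₀ ≤ a₁ := by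
  have hc35 : (0 : ℝ) ≤ c35Y := by norm_num [c35Y]
  have h1 : c * (c35Y * M * α₀) ≤ c * a₁ :=
    calc c * (c35Y * M * α₀) = c35Y * (c * M * α₀) := by ring
      _ ≤ c35Y * a39 := mul_le_mul_of_nonneg_left ha hc35
      _ ≤ c * a₁ := ha39
  exact le_of_mul_le_mul_left h1 hc

/-- ★★ **THE N06 KNIT HEAD's ROWS-15∕16 DISPLAY `h348` AT A SECTION-CARRYING MEMBER, AT ANY DOMINATED THRESHOLDS** («KE₇X»'s binder body VERBATIM at the `G′`-letter
`GpY x (parKnitY x)`): for every regularity pair `(R₁, R₂)` with the head's displayed class transfer `hRP1` into print's class (3.35) and `0 < c`, every bond map `bI`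
with `hβI`, every section-carrying member `x` with `knit348M₁ ≤ M`, every `α₀ > 0` with the head's guard `c·M·α₀ ≤ a39`, thresholds `c₃₅·a39 ≤ c·knit348a₁`,
`knit348B₀ ≤ B39`, `δ39 ≤ knit348δ₀`, and every `U ∈ (bg9YR … R₁ R₂ x).Reg335 c α₀`:
`Conv348Blk (oneCubeOps39 (geo9Y x) (bg9YR … R₁ R₂ x) (blk39F … (bI x)) (L39 x (parKnitY x) (GpY x (parKnitY x)))) B39 δ39 U`.
[cite: Balaban1985BackgroundPropagators, Thm 3.2 (3.48) p.398 + (3.96) p.411 + (3.19) p.393 + (3.35) p.396; Balaban1984PropagatorsII, (2.51) p.232 + (2.86) p.238] -/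
theorem conv348_oneCube_parKnitY_regYR_at
    {R₁ R₂ : RegFamY θ.d₆ θ.ℓ₆ θ.hd' θ.hL' θ.b₀ θ.b₁ Mstar (Matrix (Fin N) (Fin N) ℂ)} {c : ℝ} (hc : 0 < c)
    (hRP1 : ∀ (x : MemberY θ.d₆ θ.ℓ₆ θ.hd' θ.hL' θ.b₀ θ.b₁ Mstar) (α₀ : ℝ)
      (U : (bg9YR (Matrix (Fin N) (Fin N) ℂ) (specialUnitaryUnits (Fin N)) R₁ R₂ x).Cfg),
      (bg9YR (Matrix (Fin N) (Fin N) ℂ) (specialUnitaryUnits (Fin N)) R₁ R₂ x).Reg335 c α₀ U →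
        0 ≤ α₀ ∧ (bg9YP (Matrix (Fin N) (Fin N) ℂ) (specialUnitaryUnits (Fin N)) x).Reg335 c35Y α₀ U)
    (bI : ∀ x : MemberY θ.d₆ θ.ℓ₆ θ.hd' θ.hL' θ.b₀ θ.b₁ Mstar, FBondY x.toKIdx → IBondY x.toKIdx)
    (hβI : ∀ (x : MemberY θ.d₆ θ.ℓ₆ θ.hd' θ.hL' θ.b₀ θ.b₁ Mstar) (f : FBondY x.toKIdx) (c : IBondY x.toKIdx),
      blkV1 x.hN x.D f = β x.hN x.D x.hk c → β x.hN x.D x.hk (bI x f) = blkV1 x.hN x.D f)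
    {a39 B39 δ39 : ℝ} (ha39 : c35Y * a39 ≤ c * knit348a₁ N θ Mstar) (hB39 : knit348B₀ N θ Mstar ≤ B39) (hδ39 : δ39 ≤ knit348δ₀ N θ Mstar)
    (x : MemberY θ.d₆ θ.ℓ₆ θ.hd' θ.hL' θ.b₀ θ.b₁ Mstar) (hsurj : Function.Surjective (β x.hN x.D x.hk)) (hM : knit348M₁ N θ Mstar ≤ (geo9Y x).M)
    (α₀ : ℝ) (hα : 0 < α₀) (ha : c * (geo9Y x).M * α₀ ≤ a39)
    (U : (bg9YR (Matrix (Fin N) (Fin N) ℂ) (specialUnitaryUnits (Fin N)) R₁ R₂ x).Cfg)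
    (hU : (bg9YR (Matrix (Fin N) (Fin N) ℂ) (specialUnitaryUnits (Fin N)) R₁ R₂ x).Reg335 c α₀ U) :
    Conv348Blk (oneCubeOps39 (geo9Y x) (bg9YR (Matrix (Fin N) (Fin N) ℂ) (specialUnitaryUnits (Fin N)) R₁ R₂ x)
      (blk39F (Matrix (Fin N) (Fin N) ℂ) x.toKIdx (bI x)) (L39 x.toKIdx (parKnitY x.toKIdx) (GpY x.toKIdx (parKnitY x.toKIdx)))) B39 δ39 U :=
  conv348_oneCube_parKnitY_at_of_le N θ Mstar bI hβI x hsurj hM α₀ hα (guard_of_head hc ha ha39) hB39 hδ39 U (hRP1 x α₀ U hU).2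

/-- ★★ **THE SAME WITH THE `G′`-SLOT READ THROUGH A LETTERS FAMILY** `𝔏` pinned by `(𝔏 x).Gp = GpY x (parKnitY x)` — the head's LITERAL spelling
`L39 x.toKIdx (parKnitY x.toKIdx) (𝔏 x).Gp` (at the record `𝔏 := lettersYOfRecordV11K …`, pin `rfl`). [cite: Balaban1985BackgroundPropagators, Thm 3.2 (3.48) p.398 + (3.19) p.393 + (3.35) p.396 (bookkeeping: the pin)] -/
theorem conv348_oneCube_parKnitY_regYR_at_letters (𝔏 : LettersY N θ Mstar)
    (hGp : ∀ x : MemberY θ.d₆ θ.ℓ₆ θ.hd' θ.hL' θ.b₀ θ.b₁ Mstar, (𝔏 x).Gp = GpY x.toKIdx (parKnitY x.toKIdx))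
    {R₁ R₂ : RegFamY θ.d₆ θ.ℓ₆ θ.hd' θ.hL' θ.b₀ θ.b₁ Mstar (Matrix (Fin N) (Fin N) ℂ)} {c : ℝ} (hc : 0 < c)
    (hRP1 : ∀ (x : MemberY θ.d₆ θ.ℓ₆ θ.hd' θ.hL' θ.b₀ θ.b₁ Mstar) (α₀ : ℝ)
      (U : (bg9YR (Matrix (Fin N) (Fin N) ℂ) (specialUnitaryUnits (Fin N)) R₁ R₂ x).Cfg),
      (bg9YR (Matrix (Fin N) (Fin N) ℂ) (specialUnitaryUnits (Fin N)) R₁ R₂ x).Reg335 c α₀ U →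
        0 ≤ α₀ ∧ (bg9YP (Matrix (Fin N) (Fin N) ℂ) (specialUnitaryUnits (Fin N)) x).Reg335 c35Y α₀ U)
    (bI : ∀ x : MemberY θ.d₆ θ.ℓ₆ θ.hd' θ.hL' θ.b₀ θ.b₁ Mstar, FBondY x.toKIdx → IBondY x.toKIdx)
    (hβI : ∀ (x : MemberY θ.d₆ θ.ℓ₆ θ.hd' θ.hL' θ.b₀ θ.b₁ Mstar) (f : FBondY x.toKIdx) (c : IBondY x.toKIdx),
      blkV1 x.hN x.D f = β x.hN x.D x.hk c → β x.hN x.D x.hk (bI x f) = blkV1 x.hN x.D f)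
    {a39 B39 δ39 : ℝ} (ha39 : c35Y * a39 ≤ c * knit348a₁ N θ Mstar) (hB39 : knit348B₀ N θ Mstar ≤ B39) (hδ39 : δ39 ≤ knit348δ₀ N θ Mstar)
    (x : MemberY θ.d₆ θ.ℓ₆ θ.hd' θ.hL' θ.b₀ θ.b₁ Mstar) (hsurj : Function.Surjective (β x.hN x.D x.hk)) (hM : knit348M₁ N θ Mstar ≤ (geo9Y x).M)
    (α₀ : ℝ) (hα : 0 < α₀) (ha : c * (geo9Y x).M * α₀ ≤ a39)
    (U : (bg9YR (Matrix (Fin N) (Fin N) ℂ) (specialUnitaryUnits (Fin N)) R₁ R₂ x).Cfg)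
    (hU : (bg9YR (Matrix (Fin N) (Fin N) ℂ) (specialUnitaryUnits (Fin N)) R₁ R₂ x).Reg335 c α₀ U) :
    Conv348Blk (oneCubeOps39 (geo9Y x) (bg9YR (Matrix (Fin N) (Fin N) ℂ) (specialUnitaryUnits (Fin N)) R₁ R₂ x)
      (blk39F (Matrix (Fin N) (Fin N) ℂ) x.toKIdx (bI x)) (L39 x.toKIdx (parKnitY x.toKIdx) (𝔏 x).Gp)) B39 δ39 U := by
  rw [hGp x]
  exact conv348_oneCube_parKnitY_regYR_at N θ Mstar hc hRP1 bI hβI ha39 hB39 hδ39 x hsurj hM α₀ hα ha U hU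

/-- ★ **THE SAME ALONG n06-c's CARRIER `SCMemberY`** (the section packaged; `j.surjective_beta`). [cite: Balaban1985BackgroundPropagators, Thm 3.2 (3.48) p.398 + (3.35) p.396; Balaban1984PropagatorsII, (2.3) p.224 + (2.45) p.231] -/
theorem conv348_oneCube_parKnitY_regYR_at_scMemberY
    {R₁ R₂ : RegFamY θ.d₆ θ.ℓ₆ θ.hd' θ.hL' θ.b₀ θ.b₁ Mstar (Matrix (Fin N) (Fin N) ℂ)} {c : ℝ} (hc : 0 < c)
    (hRP1 : ∀ (x : MemberY θ.d₆ θ.ℓ₆ θ.hd' θ.hL' θ.b₀ θ.b₁ Mstar) (α₀ : ℝ)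
      (U : (bg9YR (Matrix (Fin N) (Fin N) ℂ) (specialUnitaryUnits (Fin N)) R₁ R₂ x).Cfg),
      (bg9YR (Matrix (Fin N) (Fin N) ℂ) (specialUnitaryUnits (Fin N)) R₁ R₂ x).Reg335 c α₀ U →
        0 ≤ α₀ ∧ (bg9YP (Matrix (Fin N) (Fin N) ℂ) (specialUnitaryUnits (Fin N)) x).Reg335 c35Y α₀ U)
    (bI : ∀ x : MemberY θ.d₆ θ.ℓ₆ θ.hd' θ.hL' θ.b₀ θ.b₁ Mstar, FBondY x.toKIdx → IBondY x.toKIdx)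
    (hβI : ∀ (x : MemberY θ.d₆ θ.ℓ₆ θ.hd' θ.hL' θ.b₀ θ.b₁ Mstar) (f : FBondY x.toKIdx) (c : IBondY x.toKIdx),
      blkV1 x.hN x.D f = β x.hN x.D x.hk c → β x.hN x.D x.hk (bI x f) = blkV1 x.hN x.D f)
    {a39 B39 δ39 : ℝ} (ha39 : c35Y * a39 ≤ c * knit348a₁ N θ Mstar) (hB39 : knit348B₀ N θ Mstar ≤ B39) (hδ39 : δ39 ≤ knit348δ₀ N θ Mstar)
    (j : SCMemberY θ.d₆ θ.ℓ₆ θ.hd' θ.hL' θ.b₀ θ.b₁ Mstar) (hM : knit348M₁ N θ Mstar ≤ (geo9Y j.val).M)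
    (α₀ : ℝ) (hα : 0 < α₀) (ha : c * (geo9Y j.val).M * α₀ ≤ a39)
    (U : (bg9YR (Matrix (Fin N) (Fin N) ℂ) (specialUnitaryUnits (Fin N)) R₁ R₂ j.val).Cfg)
    (hU : (bg9YR (Matrix (Fin N) (Fin N) ℂ) (specialUnitaryUnits (Fin N)) R₁ R₂ j.val).Reg335 c α₀ U) :
    Conv348Blk (oneCubeOps39 (geo9Y j.val) (bg9YR (Matrix (Fin N) (Fin N) ℂ) (specialUnitaryUnits (Fin N)) R₁ R₂ j.val)
      (blk39F (Matrix (Fin N) (Fin N) ℂ) j.val.toKIdx (bI j.val))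
      (L39 j.val.toKIdx (parKnitY j.val.toKIdx) (GpY j.val.toKIdx (parKnitY j.val.toKIdx)))) B39 δ39 U :=
  conv348_oneCube_parKnitY_regYR_at N θ Mstar hc hRP1 bI hβI ha39 hB39 hδ39 j.val j.surjective_beta hM α₀ hα ha U hU

end At

end Literature.MathematicalPhysics.QuantumFieldTheory.Balaban1983to89.B9Thm32KnitRows1516ThresholdsY

end
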